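import Mathlib.Data.Finset.Card
import Mathlib.Data.Fintype.Powerset
import Mathlib.Data.Set.Function
import HarnessLib

/-!
# `NoHeavyLowerTail` (crux stmt-CriticalPhenomena-4575), hull-port line hp-7: the IC/CoI-KLEITMAN conjecture for
# INTERVAL components in general position — an explicit increasing injection for EVERY family of sources and EVERY type digraph

Support file (prover `prim-hp-7`, generation 52; `--supports stmt-CriticalPhenomena-4575`).  No definitions, no `sorry`,
standard axioms.  Memo: `prim-hp-7/FROM-prim-hp-7-g52-KATONA-ANTICHAIN.md` §3.

Setting (memo g50 S2 / prim-ineq-gen-3's Conjecture O_k): the middle zone `Z` is a union of `r` INTERVALS (subcubes)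
`[x i, y i] = {ζ : x i ⊆ ζ ⊆ y i}` of the cube `2^α`, pairwise incomparable (`x i ⊄ y j` for `i ≠ j`; then the intervals are
exactly the Hasse components of `Z`, and `Z` is convex).  A SOURCE of type `(a,b)`, `a ≠ b`, is a set `ζ ∈ [x a, y a]` with
`univ ∖ ζ ∈ [x b, y b]`; a TARGET is a set lying in no interval whose complement lies in no interval.  hp-7 g50's structured
census (`icm_cubes.c`: `|α| = 6`, `≤ 5` intervals; `|α| = 7`, `≤ 3` intervals; `6·10⁷` instances) found no Hall failure.

THEOREM (`JBern.exists_injOn_target_of_intervals`, this work).  If moreover the bottoms are pairwise disjoint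
(`x i ∩ x j = ∅`) and the tops pairwise co-disjoint (`y i ∪ y j = univ`) — 'general position': then all `r(r-1)` ordered
types occur — and every pair of indices leaves a third one (`r ≥ 3`), then for EVERY family `S` of sources (no intersection /
co-intersection hypothesis, any mixture of types: opposite pairs, cyclic triangles, all tournaments) the explicit map
`φ ζ = ζ ∪ (x b ∖ y a)` (`(a,b)` the type of `ζ`) is an increasing injection of `S` into the targets.  Proof: `x b ∖ y a ≠ ∅`
by incomparability, so `φ ζ` leaves `[x a, y a]` upward and its complement leaves `[x b, y b]` downward (and no other interval
can contain them); the type is recovered from `t = φ ζ` as the unique `a` with `x a ⊆ t` and the unique `b` with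
`univ ∖ y b ⊆ t` (this is where disjoint bottoms, co-disjoint tops and a third index are used), and then `ζ = t ∖ (x b ∖ y a)`.
So in this class the conjecture holds with room to spare; for `r = 2` the same map collides on opposite types (there the
two-petal theorem `…TwoPetalCoInt` needs co-intersection), and the open cases of the conjecture live on components that are
not intervals.  Hall form: `JBern.card_filter_le_card_filter_target_of_intervals`.
[this work]
-/

namespace Summit.CriticalPhenomena.PercolationContinuityZ3.Theorems.JBern

open Finset

variable {α : Type*} [Fintype α] [DecidableEq α] {r : ℕ}

/-- **CoI-Kleitman for interval components in general position: explicit increasing injection** (this work).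
`x y : Fin r → Finset α` are the bottoms and tops of pairwise incomparable intervals (`hinc`), with pairwise disjoint
bottoms (`hxx`), pairwise co-disjoint tops (`hyy`) and a third index besides any two (`h3`).  `S` is any family of sources:
`τ ζ ≠ σ ζ`, `ζ ∈ [x (τ ζ), y (τ ζ)]`, `univ ∖ ζ ∈ [x (σ ζ), y (σ ζ)]`.  Then `ζ ↦ ζ ∪ (x (σ ζ) ∖ y (τ ζ))` is injective
on `S`, increasing, and its values and their complements lie in no interval `[x i, y i]`. [this work] -/
theorem exists_injOn_target_of_intervals (x y : Fin r → Finset α)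
    (hinc : ∀ i j, i ≠ j → ¬ x i ⊆ y j) (hxx : ∀ i j, i ≠ j → Disjoint (x i) (x j))
    (hyy : ∀ i j, i ≠ j → y i ∪ y j = univ) (h3 : ∀ a b : Fin r, ∃ c : Fin r, c ≠ a ∧ c ≠ b)
    (S : Finset (Finset α)) (τ σ : Finset α → Fin r)
    (hS : ∀ ζ ∈ S, τ ζ ≠ σ ζ ∧ x (τ ζ) ⊆ ζ ∧ ζ ⊆ y (τ ζ) ∧ x (σ ζ) ⊆ univ \ ζ ∧ univ \ ζ ⊆ y (σ ζ)) :
    ∃ φ : Finset α → Finset α, Set.InjOn φ S ∧ ∀ ζ ∈ S, ζ ⊆ φ ζ ∧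
      (∀ i, ¬ (x i ⊆ φ ζ ∧ φ ζ ⊆ y i)) ∧ (∀ i, ¬ (x i ⊆ univ \ φ ζ ∧ univ \ φ ζ ⊆ y i)) := by
  classical
  -- the map
  refine ⟨fun ζ => ζ ∪ (x (σ ζ) \ y (τ ζ)), ?_, ?_⟩
  · -- injectivity on `S`: recover the type, then the source
    -- (i) the unique bottom inside `φ ζ` is `x (τ ζ)`
    have hbot : ∀ ζ ∈ S, ∀ i, x i ⊆ ζ ∪ (x (σ ζ) \ y (τ ζ)) → i = τ ζ := by
      intro ζ hζ i hi
      obtain ⟨hab, hxa, hya, hxb, hyb⟩ := hS ζ hζ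
      by_contra hia
      -- `x i ⊄ ζ` (else `x i ⊆ y (τ ζ)`), so `x i` meets `x (σ ζ)`: `i = σ ζ`
      have hi_b : i = σ ζ := by
        by_contra hib
        have : ¬ x i ⊆ ζ := fun h => hinc i (τ ζ) hia (h.trans hya)
        obtain ⟨e, hei, heζ⟩ := not_subset.1 this
        have he := hi hei
        rw [mem_union] at he
        rcases he with he | he
        · exact heζ he
        · exact disjoint_left.1 (hxx i (σ ζ) hib) hei (mem_sdiff.1 he).1
      subst hi_b
      -- then `x (σ ζ) ⊆ x (σ ζ) \ y (τ ζ)` (it avoids `ζ`), i.e. `x (σ ζ) ∩ y (τ ζ) = ∅`; a third index is impossible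
      obtain ⟨c, hca, hcb⟩ := h3 (τ ζ) (σ ζ)
      obtain ⟨e, heb, hec⟩ := not_subset.1 (hinc (σ ζ) c (Ne.symm hcb))
      have heζ : e ∉ ζ := fun h => (mem_sdiff.1 (hxb heb)).2 h
      have hea : e ∉ y (τ ζ) := by
        have he := hi heb
        rw [mem_union] at he
        rcases he with he | he
        · exact (heζ he).elim
        · exact (mem_sdiff.1 he).2
      have : e ∈ y (τ ζ) ∪ y c := by rw [hyy (τ ζ) c (Ne.symm hca)]; exact mem_univ e
      rcases mem_union.1 this with h | h
      · exact hea h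
      · exact hec h
    -- (ii) the unique co-top inside `φ ζ` is `univ \ y (σ ζ)`
    have htop : ∀ ζ ∈ S, ∀ j, univ \ y j ⊆ ζ ∪ (x (σ ζ) \ y (τ ζ)) → j = σ ζ := by
      intro ζ hζ j hj
      obtain ⟨hab, hxa, hya, hxb, hyb⟩ := hS ζ hζ
      by_contra hjb
      have hj_a : j = τ ζ := by
        by_contra hja
        -- `univ \ y j ⊄ ζ` (else `x (σ ζ) ⊆ univ \ ζ ⊆ y j`), so it meets `x (σ ζ) \ y (τ ζ) ⊆ univ \ y (τ ζ)`
        have : ¬ univ \ y j ⊆ ζ := by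
          intro h
          refine hinc (σ ζ) j (Ne.symm hjb) fun e he => ?_
          by_contra hey
          have : e ∈ ζ := h (mem_sdiff.2 ⟨mem_univ e, hey⟩)
          exact (mem_sdiff.1 (hxb he)).2 this
        obtain ⟨e, hej, heζ⟩ := not_subset.1 this
        have he := hj hej
        rw [mem_union] at he
        rcases he with he | he
        · exact heζ he
        · have hea : e ∉ y (τ ζ) := (mem_sdiff.1 he).2
          have : e ∈ y j ∪ y (τ ζ) := by rw [hyy j (τ ζ) hja]; exact mem_univ e
          rcases mem_union.1 this with h | h
          · exact (mem_sdiff.1 hej).2 h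
          · exact hea h
      subst hj_a
      -- then `univ \ y (τ ζ) ⊆ x (σ ζ)`; a third index is impossible
      obtain ⟨c, hca, hcb⟩ := h3 (τ ζ) (σ ζ)
      obtain ⟨e, hec, hea⟩ := not_subset.1 (hinc c (τ ζ) hca)
      have he := hj (mem_sdiff.2 ⟨mem_univ e, hea⟩)
      rw [mem_union] at he
      rcases he with he | he
      · exact hea (hya he)
      · exact disjoint_left.1 (hxx c (σ ζ) hcb) hec (mem_sdiff.1 he).1
    -- (iii) conclude
    intro ζ hζ ξ hξ hφ
    have hζ' : ζ ∈ S := hζ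
    have hξ' : ξ ∈ S := hξ
    have hφ' : ζ ∪ (x (σ ζ) \ y (τ ζ)) = ξ ∪ (x (σ ξ) \ y (τ ξ)) := hφ
    obtain ⟨_, hxc, -, -, hyd⟩ := hS ξ hξ'
    have hτ : τ ξ = τ ζ := by
      refine hbot ζ hζ' (τ ξ) ?_
      rw [hφ']
      exact hxc.trans subset_union_left
    have hPξ : univ \ y (σ ξ) ⊆ ξ := fun e he => by
      by_contra heξ
      exact (mem_sdiff.1 he).2 (hyd (mem_sdiff.2 ⟨mem_univ e, heξ⟩))
    have hσ : σ ξ = σ ζ := by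
      refine htop ζ hζ' (σ ξ) ?_
      rw [hφ']
      exact hPξ.trans subset_union_left
    -- `ζ = φ ζ \ (x b \ y a)` since `ζ` avoids `x b`
    have key : ∀ η ∈ S, η = (η ∪ (x (σ η) \ y (τ η))) \ (x (σ η) \ y (τ η)) := by
      intro η hη
      obtain ⟨_, _, _, hxb', _⟩ := hS η hη
      rw [union_sdiff_cancel_right]
      exact disjoint_left.2 fun e heη heL => (mem_sdiff.1 (hxb' (mem_sdiff.1 heL).1)).2 heη
    rw [key ζ hζ', key ξ hξ', hφ', hτ, hσ]
  · intro ζ hζ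
    obtain ⟨hab, hxa, hya, hxb, hyb⟩ := hS ζ hζ
    -- the added set is non-empty
    obtain ⟨q, hqb, hqa⟩ := not_subset.1 (hinc (σ ζ) (τ ζ) (Ne.symm hab))
    have hqφ : q ∈ ζ ∪ (x (σ ζ) \ y (τ ζ)) := mem_union_right _ (mem_sdiff.2 ⟨hqb, hqa⟩)
    refine ⟨subset_union_left, fun i ⟨hxi, hyi⟩ => ?_, fun i ⟨hxi, hyi⟩ => ?_⟩
    · -- `φ ζ ∈ [x i, y i]`: then `i = τ ζ` and `q ∈ y (τ ζ)`, contradiction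
      have hi : i = τ ζ := by
        by_contra hia
        exact hinc (τ ζ) i (Ne.symm hia) (hxa.trans (subset_union_left.trans hyi))
      subst hi
      exact hqa (hyi hqφ)
    · -- `univ \ φ ζ ∈ [x i, y i]`: then `i = σ ζ` and `q ∉ φ ζ`, contradiction
      have hi : i = σ ζ := by
        by_contra hib
        exact hinc i (σ ζ) hib (hxi.trans ((sdiff_subset_sdiff subset_rfl subset_union_left).trans hyb))
      subst hi
      exact (mem_sdiff.1 (hxi hqb)).2 hqφ

/-- **Hall form** (this work): under the hypotheses of `exists_injOn_target_of_intervals`, for every family `𝒰` of sets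
(in particular every up-set) the sources in `𝒰` are at most as many as the targets lying above a source of `S ∩ 𝒰` —
here a target is a set in no interval whose complement is in no interval, and 'above a member of `𝒰`' replaces 'in `𝒰`'
(equivalent for up-sets). [this work] -/
theorem card_filter_le_card_filter_target_of_intervals (x y : Fin r → Finset α)
    (hinc : ∀ i j, i ≠ j → ¬ x i ⊆ y j) (hxx : ∀ i j, i ≠ j → Disjoint (x i) (x j))
    (hyy : ∀ i j, i ≠ j → y i ∪ y j = univ) (h3 : ∀ a b : Fin r, ∃ c : Fin r, c ≠ a ∧ c ≠ b)
    (S : Finset (Finset α)) (τ σ : Finset α → Fin r)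
    (hS : ∀ ζ ∈ S, τ ζ ≠ σ ζ ∧ x (τ ζ) ⊆ ζ ∧ ζ ⊆ y (τ ζ) ∧ x (σ ζ) ⊆ univ \ ζ ∧ univ \ ζ ⊆ y (σ ζ))
    (𝒰 : Finset (Finset α)) :
    #(S.filter fun ζ => ζ ∈ 𝒰) ≤ #((univ : Finset (Finset α)).filter fun t =>
      (∀ i, ¬ (x i ⊆ t ∧ t ⊆ y i)) ∧ (∀ i, ¬ (x i ⊆ univ \ t ∧ univ \ t ⊆ y i)) ∧ ∃ ζ ∈ S, ζ ∈ 𝒰 ∧ ζ ⊆ t) := by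
  obtain ⟨φ, hφinj, hφ⟩ := exists_injOn_target_of_intervals x y hinc hxx hyy h3 S τ σ hS
  refine card_le_card_of_injOn φ (fun ζ hζ => ?_) (hφinj.mono (coe_subset.2 (filter_subset _ _)))
  obtain ⟨hζS, hζ𝒰⟩ := mem_filter.1 hζ
  obtain ⟨hsub, h1, h2⟩ := hφ ζ hζS
  exact mem_filter.2 ⟨mem_univ _, h1, h2, ζ, hζS, hζ𝒰, hsub⟩


/-! ### Localised version (gen 52 addendum): general position is needed only on the indices carrying the types of `S`

The injectivity argument above uses disjoint bottoms / co-disjoint tops / a third index only among the indices that occur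
as tails or heads of members of `S`.  So in an ARBITRARY configuration of pairwise incomparable intervals (other pairs may be
degenerate: bottoms meeting, tops not covering), every family whose types live on a set `K` of `≥ 3` indices in general
position — e.g. a cyclic triangle with or without opposite types (`T4 = {(1,2),(2,1),(2,3),(3,1)}`), any tournament on
`K` — injects explicitly into the targets (which still have to avoid ALL intervals).  The remaining interval cases are
therefore families using a degenerate pair of indices inside their own support; there the same map can collide (memo §3). -/

/-- **CoI-Kleitman for interval components, localised general position** (this work).  As
`exists_injOn_target_of_intervals`, but disjointness of bottoms (`hxx`), co-disjointness of tops (`hyy`) and the third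
index (`h3`) are only assumed inside a set `K` of indices containing all tails `τ ζ` and heads `σ ζ` of members of `S`;
the intervals outside `K` are arbitrary (pairwise incomparability `hinc` is assumed for all pairs, as the targets must avoid
every interval). [this work] -/
theorem exists_injOn_target_of_intervals_on (x y : Fin r → Finset α) (K : Finset (Fin r))
    (hinc : ∀ i j, i ≠ j → ¬ x i ⊆ y j) (hxx : ∀ i ∈ K, ∀ j ∈ K, i ≠ j → Disjoint (x i) (x j))
    (hyy : ∀ i ∈ K, ∀ j ∈ K, i ≠ j → y i ∪ y j = univ) (h3 : ∀ a ∈ K, ∀ b ∈ K, ∃ c ∈ K, c ≠ a ∧ c ≠ b)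
    (S : Finset (Finset α)) (τ σ : Finset α → Fin r)
    (hS : ∀ ζ ∈ S, τ ζ ∈ K ∧ σ ζ ∈ K ∧ τ ζ ≠ σ ζ ∧ x (τ ζ) ⊆ ζ ∧ ζ ⊆ y (τ ζ) ∧
      x (σ ζ) ⊆ univ \ ζ ∧ univ \ ζ ⊆ y (σ ζ)) :
    ∃ φ : Finset α → Finset α, Set.InjOn φ S ∧ ∀ ζ ∈ S, ζ ⊆ φ ζ ∧
      (∀ i, ¬ (x i ⊆ φ ζ ∧ φ ζ ⊆ y i)) ∧ (∀ i, ¬ (x i ⊆ univ \ φ ζ ∧ univ \ φ ζ ⊆ y i)) := by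
  classical
  refine ⟨fun ζ => ζ ∪ (x (σ ζ) \ y (τ ζ)), ?_, ?_⟩
  · -- (i) a bottom `x i`, `i ∈ K`, inside `φ ζ` has `i = τ ζ`
    have hbot : ∀ ζ ∈ S, ∀ i ∈ K, x i ⊆ ζ ∪ (x (σ ζ) \ y (τ ζ)) → i = τ ζ := by
      intro ζ hζ i hiK hi
      obtain ⟨haK, hbK, hab, hxa, hya, hxb, hyb⟩ := hS ζ hζ
      by_contra hia
      have hi_b : i = σ ζ := by
        by_contra hib
        have : ¬ x i ⊆ ζ := fun h => hinc i (τ ζ) hia (h.trans hya)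
        obtain ⟨e, hei, heζ⟩ := not_subset.1 this
        have he := hi hei
        rw [mem_union] at he
        rcases he with he | he
        · exact heζ he
        · exact disjoint_left.1 (hxx i hiK (σ ζ) hbK hib) hei (mem_sdiff.1 he).1
      subst hi_b
      obtain ⟨c, hcK, hca, hcb⟩ := h3 (τ ζ) haK (σ ζ) hbK
      obtain ⟨e, heb, hec⟩ := not_subset.1 (hinc (σ ζ) c (Ne.symm hcb))
      have heζ : e ∉ ζ := fun h => (mem_sdiff.1 (hxb heb)).2 h
      have hea : e ∉ y (τ ζ) := by
        have he := hi heb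
        rw [mem_union] at he
        rcases he with he | he
        · exact (heζ he).elim
        · exact (mem_sdiff.1 he).2
      have : e ∈ y (τ ζ) ∪ y c := by rw [hyy (τ ζ) haK c hcK (Ne.symm hca)]; exact mem_univ e
      rcases mem_union.1 this with h | h
      · exact hea h
      · exact hec h
    -- (ii) a co-top `univ \ y j`, `j ∈ K`, inside `φ ζ` has `j = σ ζ`
    have htop : ∀ ζ ∈ S, ∀ j ∈ K, univ \ y j ⊆ ζ ∪ (x (σ ζ) \ y (τ ζ)) → j = σ ζ := by
      intro ζ hζ j hjK hj
      obtain ⟨haK, hbK, hab, hxa, hya, hxb, hyb⟩ := hS ζ hζ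
      by_contra hjb
      have hj_a : j = τ ζ := by
        by_contra hja
        have : ¬ univ \ y j ⊆ ζ := by
          intro h
          refine hinc (σ ζ) j (Ne.symm hjb) fun e he => ?_
          by_contra hey
          have : e ∈ ζ := h (mem_sdiff.2 ⟨mem_univ e, hey⟩)
          exact (mem_sdiff.1 (hxb he)).2 this
        obtain ⟨e, hej, heζ⟩ := not_subset.1 this
        have he := hj hej
        rw [mem_union] at he
        rcases he with he | he
        · exact heζ he
        · have hea : e ∉ y (τ ζ) := (mem_sdiff.1 he).2
          have : e ∈ y j ∪ y (τ ζ) := by rw [hyy j hjK (τ ζ) haK hja]; exact mem_univ e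
          rcases mem_union.1 this with h | h
          · exact (mem_sdiff.1 hej).2 h
          · exact hea h
      subst hj_a
      obtain ⟨c, hcK, hca, hcb⟩ := h3 (τ ζ) haK (σ ζ) hbK
      obtain ⟨e, hec, hea⟩ := not_subset.1 (hinc c (τ ζ) hca)
      have he := hj (mem_sdiff.2 ⟨mem_univ e, hea⟩)
      rw [mem_union] at he
      rcases he with he | he
      · exact hea (hya he)
      · exact disjoint_left.1 (hxx c hcK (σ ζ) hbK hcb) hec (mem_sdiff.1 he).1
    -- (iii) conclude
    intro ζ hζ ξ hξ hφ
    have hζ' : ζ ∈ S := hζ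
    have hξ' : ξ ∈ S := hξ
    have hφ' : ζ ∪ (x (σ ζ) \ y (τ ζ)) = ξ ∪ (x (σ ξ) \ y (τ ξ)) := hφ
    obtain ⟨hcK, hdK, _, hxc, -, -, hyd⟩ := hS ξ hξ'
    have hτ : τ ξ = τ ζ := by
      refine hbot ζ hζ' (τ ξ) hcK ?_
      rw [hφ']
      exact hxc.trans subset_union_left
    have hPξ : univ \ y (σ ξ) ⊆ ξ := fun e he => by
      by_contra heξ
      exact (mem_sdiff.1 he).2 (hyd (mem_sdiff.2 ⟨mem_univ e, heξ⟩))
    have hσ : σ ξ = σ ζ := by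
      refine htop ζ hζ' (σ ξ) hdK ?_
      rw [hφ']
      exact hPξ.trans subset_union_left
    have key : ∀ η ∈ S, η = (η ∪ (x (σ η) \ y (τ η))) \ (x (σ η) \ y (τ η)) := by
      intro η hη
      obtain ⟨_, _, _, _, _, hxb', _⟩ := hS η hη
      rw [union_sdiff_cancel_right]
      exact disjoint_left.2 fun e heη heL => (mem_sdiff.1 (hxb' (mem_sdiff.1 heL).1)).2 heη
    rw [key ζ hζ', key ξ hξ', hφ', hτ, hσ]
  · intro ζ hζ
    obtain ⟨-, -, hab, hxa, hya, hxb, hyb⟩ := hS ζ hζ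
    obtain ⟨q, hqb, hqa⟩ := not_subset.1 (hinc (σ ζ) (τ ζ) (Ne.symm hab))
    have hqφ : q ∈ ζ ∪ (x (σ ζ) \ y (τ ζ)) := mem_union_right _ (mem_sdiff.2 ⟨hqb, hqa⟩)
    refine ⟨subset_union_left, fun i ⟨hxi, hyi⟩ => ?_, fun i ⟨hxi, hyi⟩ => ?_⟩
    · have hi : i = τ ζ := by
        by_contra hia
        exact hinc (τ ζ) i (Ne.symm hia) (hxa.trans (subset_union_left.trans hyi))
      subst hi
      exact hqa (hyi hqφ)
    · have hi : i = σ ζ := by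
        by_contra hib
        exact hinc i (σ ζ) hib (hxi.trans ((sdiff_subset_sdiff subset_rfl subset_union_left).trans hyb))
      subst hi
      exact (mem_sdiff.1 (hxi hqb)).2 hqφ

end Summit.CriticalPhenomena.PercolationContinuityZ3.Theorems.JBern
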